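import Summits.CriticalPhenomena.PercolationContinuityZ3.Theorems.PercNearOneGluingAdditiveGluingDKernelOfBlockGood
import Summits.CriticalPhenomena.PercolationContinuityZ3.Theorems.PercNearOneGluingNoHeavyLowerTailSetQ9Reduction
import Summits.CriticalPhenomena.PercolationContinuityZ3.Theses.PercNearOneGluingNoHeavy
import HarnessLib

/-!
# `NoHeavyLowerTail` (stmt-CriticalPhenomena-4575): the WEAKEST block kernel of the Q9 line is the D-cone
# (block form of Kozma–Nitzan's inequality (41), no pockets), and the registered `stub_setQ9` implies it

Support file (`--supports stmt-CriticalPhenomena-4575`), route task `nh-dp-commonrelay`, gen 2.  No definitions, no named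
facts.  Everything here is glue between LANDED theorems; the point is to record on item 4575 the exact residual of the
common-relay / merge / Q9 line in its weakest sufficient form.

Notation: `u` a weighting of the pairs of `Fin n`, `μ = prodBernoulli u`, `A ∋ b` the relays, `a₀ ∈ A` a minimiser of
`a ↦ μ(a ↔ b)` over `A` in the UN-glued graph, `S` a block of vertices disjoint from `A`, `u/S` the weighting with all
pairs inside `S` set to `1` (gluing `S`).

* **D-cone** (`DCone` below, the hypothesis of the sibling crux's landed `additiveGluing_of_dcone`):
  `μ_{u/S}((S ↔ A) ∩ (a₀ ↔ b)) ≤ μ_{u/S}(S ↔ b)` for all such data.  Un-glued this reads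
  `μ(S ↔ A′, S ↮ b, S ↮ a₀, a₀ ↔ b) ≤ μ(S ↔ b, S ↮ a₀)` (`A′ = A ∖ {a₀, b}`): Kozma–Nitzan's (41) for the observer
  SET `S` against the un-glued minimiser.  For `S` a set of pendant leaves it is literally Question 9 of
  [KozmaNitzan2024, p. 36] (split the observer `0` into one leaf per edge: `u/S = G`, `argmin_u = argmin_{G−0}`), and for a
  point observer `S = {x}` it is their Question 7; conversely `DCone` for `(u, S)` is Question 9 for the apex graph
  `u + (0 —1— s, s ∈ S)`.  So `DCone` = "the answer to KN Question 9 is yes, for every graph".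
* **`dcone_of_setQ9`**: the registered stub `stub_setQ9` (set form of Question 9 = block GOODNESS with min-selection
  pockets, `μ_{u/S}(a₀ ↔ b) ≤ Φ_u(S)`) implies `DCone` instance-wise — goodness is (41) plus the non-negative dead-pocket
  drift (the sibling seat's `dKernel_of_blockGood`), so the pockets can simply be dropped.
* **`noHeavyLowerTail_of_dcone`** (both routes): `DCone ⇒ AdditiveGluing ⇒ NearOneGluing ⇒ ManyFingersLargePocket ⇒
  NoHeavyLowerTail`, all landed (`additiveGluing_of_dcone`, `additiveGluingSuffices_proof`,
  `manyFingersLargePocket_of_nearOneGluing`, `noHeavyLowerTail_of_manyFingersLargePocket`).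
Consequence for the planners: the residual of the line `common-relay-interpolation` (stubs `stub_commonRelay ⇐
stub_badObserverGlueStep ⇐ stub_mergeStep(SD) ⇐ stub_setQ9`, gen 0–1) may be taken to be `DCone` — pocket-free, and the
same statement as the residual of the sibling crux's D-line; nothing weaker than a positive answer to KN Question 9 is
needed by either, and nothing stronger.
[cite: KozmaNitzan2024, §1 (3) p. 3, §3.2 (Definition p. 12), §5.5 Questions 7 and 9 (p. 36)]
-/

namespace Summit.CriticalPhenomena.PercolationContinuityZ3.Theorems

open MeasureTheory Set
open Literature.Probability.LatticeModels (prodBernoulli)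
open Literature.Probability.Percolation (BondConfig openConn openConnIn openGraph openCluster)
open scoped BigOperators

noncomputable section
open Classical

section DConeReduction
open Literature.Probability.LatticeModels Literature.Probability.Percolation

/-- **`stub_setQ9 ⇒ D-cone`, instance-wise.**  Block goodness with min-selection pockets for `(u, A, S, b, a₀)` (for
every selection `sel`) implies the D-kernel `μ_{u/S}((S↔A) ∩ (a₀↔b)) ≤ μ_{u/S}(S↔b)`: choose `sel W` a minimiser of
`a ↦ μ(a ↔ b in Wᶜ)` over `A` and drop the pockets with `dKernel_of_blockGood`.  No minimality of `a₀` is used here.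
[cite: KozmaNitzan2024, §3.2 (Definition p. 12), Question 9 (p. 36)] -/
theorem dKernel_of_setQ9_instance {n : ℕ} (u : Sym2 (Fin n) → unitInterval) (A S : Finset (Fin n)) (b a₀ : Fin n)
    (hb : b ∈ A) (ha₀ : a₀ ∈ A)
    (hBG : ∀ sel : Finset (Fin n) → Fin n, (∀ W, sel W ∈ A) →
      (prodBernoulli u).real (openConn a₀ b)
          + (prodBernoulli u).real ((openConn a₀ b)ᶜ ∩ (⋃ s ∈ S, openConn a₀ s) ∩ (⋃ s ∈ S, openConn s b))
        ≤ (prodBernoulli u).real (⋃ s ∈ S, openConn s b)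
          + ∑ W ∈ (Finset.univ : Finset (Finset (Fin n))).filter (fun W => Disjoint W A),
              (prodBernoulli u).real {ω : BondConfig (Fin n) | ∀ z : Fin n, (z ∈ W ↔ ω ∈ ⋃ s ∈ S, openConn s z)}
                * (prodBernoulli u).real (openConnIn ((W : Set (Fin n))ᶜ) (sel W) b)) :
    (prodBernoulli (fun e : Sym2 (Fin n) => if (∀ y ∈ e, y ∈ S) ∧ ¬ e.IsDiag then 1 else u e)).real
        ((⋃ v ∈ S, ⋃ a ∈ A, openConn v a) ∩ openConn a₀ b)
      ≤ (prodBernoulli (fun e : Sym2 (Fin n) => if (∀ y ∈ e, y ∈ S) ∧ ¬ e.IsDiag then 1 else u e)).real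
        (⋃ v ∈ S, openConn v b) := by
  rcases S.eq_empty_or_nonempty with hS | hS
  · -- empty block: the left-hand event is empty
    subst hS
    have h0 : ((⋃ v ∈ (∅ : Finset (Fin n)), ⋃ a ∈ A, (openConn v a : Set (BondConfig (Fin n)))) ∩ openConn a₀ b) = ∅ := by
      simp
    rw [h0, measureReal_empty]
    exact measureReal_nonneg
  · -- nonempty block: a minimising selection and `dKernel_of_blockGood`
    set f : Finset (Fin n) → Fin n → ℝ := fun W a => (prodBernoulli u).real (openConnIn ((W : Set (Fin n))ᶜ) a b) with hf
    have hex : ∀ W : Finset (Fin n), ∃ a ∈ A, ∀ a' ∈ A, f W a ≤ f W a' := fun W =>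
      Finset.exists_min_image A (f W) ⟨b, hb⟩
    choose sel hselA hselmin using hex
    have hBGsel := hBG sel hselA
    have hinf : ∀ W : Finset (Fin n),
        A.inf' ⟨b, hb⟩ (fun a => (prodBernoulli u).real (openConnIn ((W : Set (Fin n))ᶜ) a b)) = f W (sel W) := by
      intro W
      apply le_antisymm
      · exact Finset.inf'_le _ (hselA W)
      · exact Finset.le_inf' _ _ (fun a ha => hselmin W a ha)
    refine dKernel_of_blockGood u A S b a₀ hb hS ha₀ ?_
    have hsum : (∑ W ∈ (Finset.univ : Finset (Finset (Fin n))).filter (fun W => Disjoint W A),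
              (prodBernoulli u).real
                  {ω : BondConfig (Fin n) | ∀ z : Fin n, (z ∈ W ↔ ω ∈ ⋃ v ∈ S, openConn v z)}
                * A.inf' ⟨b, hb⟩ (fun a => (prodBernoulli u).real (openConnIn ((W : Set (Fin n))ᶜ) a b)))
        = ∑ W ∈ (Finset.univ : Finset (Finset (Fin n))).filter (fun W => Disjoint W A),
              (prodBernoulli u).real {ω : BondConfig (Fin n) | ∀ z : Fin n, (z ∈ W ↔ ω ∈ ⋃ s ∈ S, openConn s z)}
                * (prodBernoulli u).real (openConnIn ((W : Set (Fin n))ᶜ) (sel W) b) := by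
      refine Finset.sum_congr rfl fun W _ => ?_
      rw [hinf W]
    rw [hsum]
    exact hBGsel

/-- The D-cone `⇐` the set form of Question 9 (`stub_setQ9`), at the level of the ∀-closed statements.
[cite: KozmaNitzan2024, Question 9 (p. 36)] -/
theorem dcone_of_setQ9
    (hCK : ∀ (n : ℕ) (u : Sym2 (Fin n) → unitInterval) (A S : Finset (Fin n)) (b a₀ : Fin n)
      (sel : Finset (Fin n) → Fin n),
      b ∈ A → Disjoint S A → (∀ W, sel W ∈ A) → a₀ ∈ A →
      (∀ a ∈ A, (prodBernoulli u).real (openConn a₀ b) ≤ (prodBernoulli u).real (openConn a b)) →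
      ((prodBernoulli u).real (openConn a₀ b)
          + (prodBernoulli u).real ((openConn a₀ b)ᶜ ∩ (⋃ s ∈ S, openConn a₀ s) ∩ (⋃ s ∈ S, openConn s b))
        ≤ (prodBernoulli u).real (⋃ s ∈ S, openConn s b)
          + ∑ W ∈ (Finset.univ : Finset (Finset (Fin n))).filter (fun W => Disjoint W A),
              (prodBernoulli u).real {ω : BondConfig (Fin n) | ∀ z : Fin n, (z ∈ W ↔ ω ∈ ⋃ s ∈ S, openConn s z)}
                * (prodBernoulli u).real (openConnIn ((W : Set (Fin n))ᶜ) (sel W) b))) :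
    ∀ (n : ℕ) (u : Sym2 (Fin n) → unitInterval) (A S : Finset (Fin n)) (b a₀ : Fin n),
      b ∈ A → Disjoint S A → a₀ ∈ A →
      (∀ a ∈ A, (prodBernoulli u).real (openConn a₀ b) ≤ (prodBernoulli u).real (openConn a b)) →
      (prodBernoulli (fun e : Sym2 (Fin n) => if (∀ y ∈ e, y ∈ S) ∧ ¬ e.IsDiag then 1 else u e)).real
          ((⋃ v ∈ S, ⋃ a ∈ A, openConn v a) ∩ openConn a₀ b)
        ≤ (prodBernoulli (fun e : Sym2 (Fin n) => if (∀ y ∈ e, y ∈ S) ∧ ¬ e.IsDiag then 1 else u e)).real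
          (⋃ v ∈ S, openConn v b) :=
  fun n u A S b a₀ hb hSA ha₀ hmin =>
    dKernel_of_setQ9_instance u A S b a₀ hb ha₀ (fun sel hsel => hCK n u A S b a₀ sel hb hSA hsel ha₀ hmin)

/-- **D-cone ⇒ `NoHeavyLowerTail`** (crux stmt-CriticalPhenomena-4575, route `PercNearOneGluing`): the pocket-free block
form of Kozma–Nitzan's (41) against the un-glued minimiser — equivalently a positive answer to their Question 9 for every
graph — implies the crux, through `AdditiveGluing` (`additiveGluing_of_dcone`), `NearOneGluing`
(`additiveGluingSuffices_proof`) and the residual `ManyFingersLargePocket`.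
[cite: KozmaNitzan2024, Conjecture 3 (p. 15), Question 9 (p. 36)] -/
theorem noHeavyLowerTail_of_dcone
    (hD : ∀ (n : ℕ) (u : Sym2 (Fin n) → unitInterval) (A S : Finset (Fin n)) (b a₀ : Fin n),
      b ∈ A → Disjoint S A → a₀ ∈ A →
      (∀ a ∈ A, (prodBernoulli u).real (openConn a₀ b) ≤ (prodBernoulli u).real (openConn a b)) →
      (prodBernoulli (fun e : Sym2 (Fin n) => if (∀ y ∈ e, y ∈ S) ∧ ¬ e.IsDiag then 1 else u e)).real
          ((⋃ v ∈ S, ⋃ a ∈ A, openConn v a) ∩ openConn a₀ b)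
        ≤ (prodBernoulli (fun e : Sym2 (Fin n) => if (∀ y ∈ e, y ∈ S) ∧ ¬ e.IsDiag then 1 else u e)).real
          (⋃ v ∈ S, openConn v b)) :
    Summit.CriticalPhenomena.PercolationContinuityZ3.Theses.PercNearOneGluing.NoHeavyLowerTail :=
  noHeavyLowerTail_of_manyFingersLargePocket
    (manyFingersLargePocket_of_nearOneGluing (additiveGluingSuffices_proof (additiveGluing_of_dcone hD)))

/-- Same, typed against the sibling route `PercNearOneGluingNoHeavy`. [cite: KozmaNitzan2024, Conjecture 3 (p. 15)] -/
theorem noHeavyLowerTail_noHeavy_of_dcone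
    (hD : ∀ (n : ℕ) (u : Sym2 (Fin n) → unitInterval) (A S : Finset (Fin n)) (b a₀ : Fin n),
      b ∈ A → Disjoint S A → a₀ ∈ A →
      (∀ a ∈ A, (prodBernoulli u).real (openConn a₀ b) ≤ (prodBernoulli u).real (openConn a b)) →
      (prodBernoulli (fun e : Sym2 (Fin n) => if (∀ y ∈ e, y ∈ S) ∧ ¬ e.IsDiag then 1 else u e)).real
          ((⋃ v ∈ S, ⋃ a ∈ A, openConn v a) ∩ openConn a₀ b)
        ≤ (prodBernoulli (fun e : Sym2 (Fin n) => if (∀ y ∈ e, y ∈ S) ∧ ¬ e.IsDiag then 1 else u e)).real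
          (⋃ v ∈ S, openConn v b)) :
    Summit.CriticalPhenomena.PercolationContinuityZ3.Theses.PercNearOneGluingNoHeavy.NoHeavyLowerTail :=
  noHeavyLowerTail_of_dcone hD

end DConeReduction

end

end Summit.CriticalPhenomena.PercolationContinuityZ3.Theorems
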